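import Summits.CriticalPhenomena.PercolationContinuityZ3.Theses.PercNearOneGluing
import Literature.Probability.Percolation.PercolationProofs

/-!
# Crux `PercNearOneGluing.NoHeavyLowerTail` (stmt-CriticalPhenomena-4575), line `bhk-superadditivity-thinning` —
# the residual `stub_manyFingersLargePocket` from the max-pioneer charging inequality (stub
# `manyFingersLargePocket_of_maxPioneerCharging`)

Lead `prover-line-stmt-CriticalPhenomena-4575-c3-0`, 2026-08-16; lands with
`--supports stmt-CriticalPhenomena-4575`.

`MAXD` (max-pioneer charging) is the typed candidate strengthening of the crux: on a finite weighted
graph (`Fin n`, weights `w`, measure `prodBernoulli w`), for a relay set `A`, an observer `o ∉ A`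
and a target `b ∈ A`, the gluing defect `P(o ↔ A, o ↮ b)` is at most
`Σ_{a ∈ A} P(E_a) · P(a ↮ b)`, where `E_a` is the event "`a` is a pioneer of `o` (joined to `o` by an
open path whose interior avoids `A`) and no other pioneer beats `a`" (`a'` beats `a` iff
`P(a' ↮ b) > P(a ↮ b)`, ties broken towards the larger index).

This file records, kernel-checked, that `MAXD` closes the line's residual
`stub_manyFingersLargePocket` (ε–δ form) with `δ := ε`, `d₀ := 0`, `s₀ := 1`:
* the residual event `{o ↮ a₀, 1 ≤ |C(o) ∩ (A∖a₀)|, …}` lies in `{o ↔ A} ∩ {o ↮ a₀}`;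
* `MAXD` at `b := a₀` bounds the latter by `Σ_a P(E_a) · P(a ↮ a₀) ≤ δ · Σ_a P(E_a)`
  (pairwise budget `P(a ↮ a₀) ≤ δ`);
* the events `E_a`, `a ∈ A`, are pairwise disjoint (the relation "beats-or-equals" is
  antisymmetric), so `Σ_a P(E_a) = P(⋃_a E_a) ≤ 1`.
-/

namespace Summit.CriticalPhenomena.PercolationContinuityZ3.Theorems

open scoped Classical BigOperators
open MeasureTheory Set
open Literature.Probability.LatticeModels (prodBernoulli)
open Literature.Probability.Percolation (openConn openConnIn BondConfig measurableSet_openConn_holds)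

/-- Pairwise disjointness of the "selected pioneer" events: with a score `r` and ties broken by the
order of the index type, the events `{ω ∈ P a ∧ ∀ a' ∈ A, ω ∈ P a' → (r a' < r a ∨ (r a' = r a ∧ a' ≤ a))}`
(`a` is present and beats-or-equals every present `a'`) are pairwise disjoint over `a ∈ A`, because
"beats-or-equals" is antisymmetric. -/
private theorem pairwiseDisjoint_selected {Ω ι : Type*} [PartialOrder ι] (A : Finset ι)
    (P : ι → Set Ω) (r : ι → ℝ) :
    (↑A : Set ι).PairwiseDisjoint fun a =>
      {ω : Ω | ω ∈ P a ∧ ∀ a' ∈ A, ω ∈ P a' → (r a' < r a ∨ (r a' = r a ∧ a' ≤ a))} := by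
  intro a ha a' ha' hne
  rw [Function.onFun, Set.disjoint_left]
  rintro ω ⟨hPa, hba⟩ ⟨hPa', hba'⟩
  have h1 := hba a' ha' hPa'
  have h2 := hba' a ha hPa
  rcases h1 with h1 | ⟨h1, h1'⟩ <;> rcases h2 with h2 | ⟨h2, h2'⟩
  · exact lt_asymm h1 h2
  · exact absurd (h2 ▸ h1) (lt_irrefl _)
  · exact absurd (h1 ▸ h2) (lt_irrefl _)
  · exact hne (le_antisymm h2' h1')

/-- The charging sum is at most the budget: if the events `E a`, `a ∈ A`, are pairwise disjoint
under a probability measure on a discrete space and every score satisfies `r a ≤ δ` with `0 ≤ δ`,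
then `Σ_{a ∈ A} P(E a) · r a ≤ δ` (since `Σ_a P(E a) = P(⋃_a E a) ≤ 1`). -/
private theorem sum_measureReal_mul_le_of_pairwiseDisjoint {Ω ι : Type*} [MeasurableSpace Ω]
    [DiscreteMeasurableSpace Ω] (μ : Measure Ω) [IsProbabilityMeasure μ] (A : Finset ι)
    (E : ι → Set Ω) (r : ι → ℝ) (δ : ℝ) (hδ : 0 ≤ δ) (hr : ∀ a ∈ A, r a ≤ δ)
    (hdisj : (↑A : Set ι).PairwiseDisjoint E) :
    ∑ a ∈ A, μ.real (E a) * r a ≤ δ := by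
  calc ∑ a ∈ A, μ.real (E a) * r a ≤ ∑ a ∈ A, μ.real (E a) * δ :=
        Finset.sum_le_sum fun a ha => mul_le_mul_of_nonneg_left (hr a ha) measureReal_nonneg
    _ = (∑ a ∈ A, μ.real (E a)) * δ := (Finset.sum_mul _ _ _).symm
    _ = μ.real (⋃ a ∈ A, E a) * δ := by
        rw [measureReal_biUnion_finset hdisj fun _ _ => MeasurableSet.of_discrete]
    _ ≤ 1 * δ := mul_le_mul_of_nonneg_right measureReal_le_one hδ
    _ = δ := one_mul δ

/-- **Stub `manyFingersLargePocket_of_maxPioneerCharging`** (line `bhk-superadditivity-thinning` of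
crux stmt-CriticalPhenomena-4575): the max-pioneer charging inequality `MAXD` — "the gluing defect
`P(o ↔ A, o ↮ b)` is at most the expected unreliability `P(a ↮ b)` of `o`'s worst pioneer `a`" —
implies the line's residual `stub_manyFingersLargePocket` in its registered ε–δ form, with
`δ := ε`, `d₀ := 0`, `s₀ := 1`.  Proof: the residual event (hub `a₀` not reached, at least one other
relay point reached) lies in `{o ↔ A} ∩ {o ↮ a₀}`; `MAXD` at `b := a₀` and the pairwise budget
`P(a ↮ a₀) ≤ δ` bound its probability by `δ · Σ_a P(E_a)`, and the selected-pioneer events `E_a`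
are pairwise disjoint, so `Σ_a P(E_a) ≤ 1`. -/
theorem manyFingersLargePocket_of_maxPioneerCharging : (∀ (n : ℕ) (w : Sym2 (Fin n) → unitInterval) (A : Finset (Fin n)) (o b : Fin n), b ∈ A → o ∉ A → (Literature.Probability.LatticeModels.prodBernoulli w).real ((⋃ a ∈ A, Literature.Probability.Percolation.openConn o a) ∩ (Literature.Probability.Percolation.openConn o b)ᶜ) ≤ ∑ a ∈ A, (Literature.Probability.LatticeModels.prodBernoulli w).real {ω : Literature.Probability.Percolation.BondConfig (Fin n) | ω ∈ Literature.Probability.Percolation.openConnIn ((↑A : Set (Fin n))ᶜ ∪ {o, a}) o a ∧ ∀ a' ∈ A, ω ∈ Literature.Probability.Percolation.openConnIn ((↑A : Set (Fin n))ᶜ ∪ {o, a'}) o a' → ((Literature.Probability.LatticeModels.prodBernoulli w).real (Literature.Probability.Percolation.openConn a' b)ᶜ < (Literature.Probability.LatticeModels.prodBernoulli w).real (Literature.Probability.Percolation.openConn a b)ᶜ ∨ ((Literature.Probability.LatticeModels.prodBernoulli w).real (Literature.Probability.Percolation.openConn a' b)ᶜ = (Literature.Probability.LatticeModels.prodBernoulli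 w).real (Literature.Probability.Percolation.openConn a b)ᶜ ∧ a' ≤ a))} * (Literature.Probability.LatticeModels.prodBernoulli w).real (Literature.Probability.Percolation.openConn a b)ᶜ) → (∀ ε : ℝ, 0 < ε → ∃ (δ : ℝ) (d₀ s₀ : ℕ), 0 < δ ∧ ∀ (n : ℕ) (w : Sym2 (Fin n) → unitInterval) (A : Finset (Fin n)) (o a₀ : Fin n), a₀ ∈ A → o ∉ A → (∀ a ∈ A, ∀ a' ∈ A, (Literature.Probability.LatticeModels.prodBernoulli w).real (Literature.Probability.Percolation.openConn a a')ᶜ ≤ δ) → (Literature.Probability.LatticeModels.prodBernoulli w).real (⋃ a ∈ A, Literature.Probability.Percolation.openConn o a)ᶜ ≤ δ → (Literature.Probability.LatticeModels.prodBernoulli w).real {ω : Literature.Probability.Percolation.BondConfig (Fin n) | ω ∉ Literature.Probability.Percolation.openConn o a₀ ∧ s₀ ≤ ((A.erase a₀).filter fun a => ω ∈ Literature.Probability.Percolation.openConn o a).card ∧ 2 * ((A.erase a₀).filter fun a => ω ∈ Literature.Probability.Percolation.openConn o a).card ≤ A.card ∧ d₀ < (A.filter fun a => ω ∈ Literature.Probability.Percolation.openConnIn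 ((↑A : Set (Fin n))ᶜ ∪ {o, a}) o a).card} ≤ ε) := by
  intro hMAXD ε hε
  refine ⟨ε, 0, 1, hε, fun n w A o a₀ ha₀ ho hpair _ => ?_⟩
  -- the residual event lies in `{o ↔ A} ∩ {o ↮ a₀}`
  have hsub : {ω : BondConfig (Fin n) | ω ∉ openConn o a₀ ∧
      1 ≤ ((A.erase a₀).filter fun a => ω ∈ openConn o a).card ∧
      2 * ((A.erase a₀).filter fun a => ω ∈ openConn o a).card ≤ A.card ∧
      0 < (A.filter fun a => ω ∈ openConnIn ((↑A : Set (Fin n))ᶜ ∪ {o, a}) o a).card} ⊆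
      (⋃ a ∈ A, openConn o a) ∩ (openConn o a₀)ᶜ := by
    rintro ω ⟨h0, h1, -, -⟩
    obtain ⟨a, ha⟩ := Finset.card_pos.mp h1
    rw [Finset.mem_filter] at ha
    exact ⟨Set.mem_iUnion₂.mpr ⟨a, Finset.mem_of_mem_erase ha.1, ha.2⟩, h0⟩
  -- `MAXD` at `b := a₀`, then the charging sum is at most the budget `ε`
  refine (measureReal_mono hsub).trans ((hMAXD n w A o a₀ ha₀ ho).trans ?_)
  exact sum_measureReal_mul_le_of_pairwiseDisjoint (prodBernoulli w) A _
    (fun a => (prodBernoulli w).real (openConn a a₀)ᶜ) ε hε.le (fun a ha => hpair a ha a₀ ha₀)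
    (pairwiseDisjoint_selected A
      (fun a => openConnIn ((↑A : Set (Fin n))ᶜ ∪ {o, a}) o a)
      (fun a => (prodBernoulli w).real (openConn a a₀)ᶜ))

end Summit.CriticalPhenomena.PercolationContinuityZ3.Theorems
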